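import Summits.CriticalPhenomena.PercolationContinuityZ3.Theorems.PercNearOneGluingNoHeavyQuantFarGate3BoxCert
import HarnessLib

/-!
# QUANT lane R8, front "FAR beyond trees", layer one — THE DEGREE-THREE GATE AT THE OBSERVER, XLV: box-certificate kernel IV — k-d trees of box
# certificates with `nn`-window chains, and the coverage theorem `BoxCover.tree_sound`

builds on p205010 (kernel theorem, internal audit signed; external expert review pending)

Support file (`--supports stmt-CriticalPhenomena-4575`), seat `prim-quant-p1` (gen 31); memo
`run/shared/lean/prim/quant/prim-quant-p1-g31/FOR-LEAD-GATE3-BOXES.md`.  Mathlib-only + files XLI–XLIV; standard axioms; no sorries.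
GENERATED by `work/lean/gen_boxcover.py`.

A REGION is a rational box `QBox` in `(p, r₁, r₂)`.  A `Tree` is either a `node` (split the box at a rational threshold along one axis) or a
`leaf` carrying a CHAIN of certificates (file XLIV) whose boxes contain the region and whose `nn`-windows `[SS/D, SE/D] ∋ nn·p` (open below if
`sfree`, above if `efree`) overlap consecutively from `nn·p = p_lo` to `+∞`.  `covers t B` checks all of this (and `BoxCert.check` of every
certificate) computably; `tree_sound`: `covers t B = true` implies the 8-cell statement for all `(p, r₁, r₂) ∈ B` with `0 < p`, `0 ≤ r₁ ≤ r₂ < 1`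
and all `nn ≥ 1`.  Data files state region theorems with short statements and prove them by `tree_sound <tree literal> <box> (by decide)`.
[this work].
-/

namespace Summit.CriticalPhenomena.PercolationContinuityZ3.Theorems

namespace Quant

namespace BoxCover

open BoxPoly BoxCert

/-- A rational parameter box `[plo, phi] × [r1lo, r1hi] × [r2lo, r2hi]`. -/
structure QBox where
  plo : ℚ
  phi : ℚ
  r1lo : ℚ
  r1hi : ℚ
  r2lo : ℚ
  r2hi : ℚ

/-- Replace the upper (`upper = true`) or lower end of axis `ax` (0 = p, 1 = r₁, 2 = r₂) by `t`. -/
def QBox.cut (B : QBox) (ax : ℕ) (t : ℚ) (upper : Bool) : QBox :=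
  match ax, upper with
  | 0, true => { B with phi := t }
  | 0, false => { B with plo := t }
  | 1, true => { B with r1hi := t }
  | 1, false => { B with r1lo := t }
  | _, true => { B with r2hi := t }
  | _, false => { B with r2lo := t }

/-- k-d tree of certificate chains. -/
inductive Tree where
  | leaf (chain : List Cert) : Tree
  | node (ax : ℕ) (t : ℚ) (tlo thi : Tree) : Tree

/-- The certificate's integer `(p, w₁, w₂)`-box contains the part of the rational `(p, r₁, r₂)`-box `B` where `r₂ ≥ r₁` (the `r₂`-lower
bound is `max B.r2lo B.r1lo`). -/
def certContains (c : Cert) (B : QBox) : Bool :=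
  decide (0 < c.D) && decide ((c.P0 : ℚ) ≤ c.D * B.plo) && decide ((c.D : ℚ) * B.phi ≤ c.P1) &&
    decide ((c.U0 : ℚ) ≤ c.D * (1 - B.r1hi)) && decide ((c.D : ℚ) * (1 - B.r1lo) ≤ c.U1) &&
    decide ((c.V0 : ℚ) ≤ c.D * (1 - B.r2hi)) && decide ((c.D : ℚ) * (1 - max B.r2lo B.r1lo) ≤ c.V1)

/-- Affine functions: an inequality at both ends of an interval holds in between. -/
theorem affine_le_between (a b a' b' lo hi x : ℝ) (hlo : a + b * lo ≤ a' + b' * lo) (hhi : a + b * hi ≤ a' + b' * hi) (h1 : lo ≤ x)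
    (h2 : x ≤ hi) : a + b * x ≤ a' + b' * x := by
  by_cases hb : b ≤ b'
  · have h := mul_le_mul_of_nonneg_left h1 (sub_nonneg.2 hb); linarith
  · push Not at hb
    have h := mul_le_mul_of_nonneg_left h2 (sub_nonneg.2 hb.le); linarith

/-- Window link `prev → c` at parameter `p`: the lower end of `c`'s window, `(SS + SS1·p)/D`, is at most the upper end of `prev`'s. -/
def linkAt (prev c : Cert) (p : ℚ) : Bool := decide (((c.SS : ℚ) + c.SS1 * p) * prev.D ≤ ((prev.SE : ℚ) + prev.SE1 * p) * c.D)

/-- `c`'s window starts at `nn ≤ 1` at parameter `p`: `SS + SS1·p ≤ D·p`. -/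
def startAt (c : Cert) (p : ℚ) : Bool := decide ((c.SS : ℚ) + c.SS1 * p ≤ c.D * p)

/-- Window chaining after certificate `prev` (links checked at both ends of the box's `p`-range; the window ends are affine in `p`). -/
def tailOk (B : QBox) (prev : Cert) : List Cert → Bool
  | [] => prev.efree
  | c :: rest => (prev.efree || c.sfree || (linkAt prev c B.plo && linkAt prev c B.phi)) && tailOk B c rest

/-- The windows of the chain cover `nn ∈ [1, ∞)` for every `p` of the box. -/
def chainOk (B : QBox) : List Cert → Bool
  | [] => false
  | c :: rest => (c.sfree || (startAt c B.plo && startAt c B.phi)) && tailOk B c rest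

/-- The tree `t` covers the box `B` (recursion on a fuel parameter, for cheap kernel evaluation): every leaf chain is checked, contains its
sub-box and has chained windows. -/
def covers : ℕ → Tree → QBox → Bool
  | 0, _, _ => false
  | _ + 1, Tree.leaf chain, B => chainOk B chain && chain.all (fun c => check c && certContains c B)
  | fuel + 1, Tree.node ax t tlo thi, B => covers fuel tlo (B.cut ax t true) && covers fuel thi (B.cut ax t false)

/-- The 8-cell statement at `(p, r₁, r₂, nn)` holds for a checked certificate containing the point, given the window position of `nn·p`
relative to the certificate (restatement of `BoxCert.sound` with box hypotheses read off `certContains`). -/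
theorem cert_apply (c : Cert) (B : QBox) (hchk : check c = true) (hcont : certContains c B = true) (p r₁ r₂ nn : ℝ)
    (hplo : (B.plo : ℝ) ≤ p) (hphi : p ≤ B.phi) (h1lo : (B.r1lo : ℝ) ≤ r₁) (h1hi : r₁ ≤ B.r1hi) (h2lo : (B.r2lo : ℝ) ≤ r₂) (h2hi : r₂ ≤ B.r2hi)
    (hp : 0 < p) (hr10 : 0 ≤ r₁) (hr12 : r₁ ≤ r₂) (hr2 : r₂ < 1)
    (hwS : c.sfree = true ∨ (c.SS : ℝ) + c.SS1 * p ≤ c.D * p * nn) (hwE : c.efree = true ∨ (c.D : ℝ) * p * nn ≤ c.SE + c.SE1 * p) :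
    ∀ (a0 a1 a2 b1 b2 c0 c1 d : ℝ), 0 ≤ a0 → 0 ≤ a1 → 0 ≤ a2 → 0 ≤ b1 → 0 ≤ b2 → 0 ≤ c0 → 0 ≤ c1 → 0 ≤ d →
        b1 * (b2 + (c0 + c1)) ≤ (a0 + a1 + a2) * d →
        b2 * (b1 + (c0 + c1)) ≤ (a0 + a1 + a2) * d →
        (c0 + c1) * (b1 + b2) ≤ (a0 + a1 + a2) * d →
        b1 * (a1 + a2 + c1 + d) ≤ d * (a0 + b1 + b2 + c0) →
        b2 * (a1 + a2 + c1 + d) ≤ d * (a0 + b1 + b2 + c0) →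
        c0 * (a1 + a2 + c1 + d) ≤ (c1 + d) * (a0 + b1 + b2 + c0) →
        0 < p * ((1 - r₁) * (1 - r₂)) * (a0 + c0) - (1 - p) * a2 - (1 - p) * ((1 - r₁) * (1 - r₂)) * d →
        0 < (1 - p) * (1 - r₁) * b1 - p * (r₂ * (1 - r₁)) * a0 - p * (1 - r₁) * a1 - (1 - p * r₁) * a2 - (1 - (1 - p) * (1 - r₂)) * (1 - r₁) * b2 - p * ((1 - r₁) * (1 - r₂)) * c1 →
        0 < (1 - p) * (1 - r₂) * b2 - p * (r₁ * (1 - r₂)) * a0 - p * (1 - r₂) * a1 - (1 - p * r₂) * a2 - (1 - (1 - p) * (1 - r₁)) * (1 - r₂) * b1 - p * ((1 - r₁) * (1 - r₂)) * c1 →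
        0 < (1 - p * max r₁ r₂ - nn * p * (1 - max r₁ r₂)) * a1 + (1 - p * (r₁ + r₂ * (1 - r₁)) - nn * p * ((1 - r₁) * (1 - r₂))) * c1 - nn * p * (r₁ + r₂ * (1 - r₁) - max r₁ r₂) * a0 - nn * ((1 - (1 - p) * (1 - r₁)) * (1 - r₂)) * b1 - nn * ((1 - (1 - p) * (1 - r₂)) * (1 - r₁)) * b2 →
        0 < (p * (1 + r₁ + r₂ + nn * max r₁ r₂) - 2) * a0 + (p * (1 + r₁ + r₂) + p * max r₁ r₂ * (nn - 1) - 1) * a1 + (p * (1 + r₁ + r₂) + nn - 2) * a2 + ((1 - (1 - p) * (1 - r₁)) * (1 + r₂ * (nn + 1)) - 1) * b1 + ((1 - (1 - p) * (1 - r₂)) * (1 + r₁ * (nn + 1)) - 1) * b2 + (p * (1 + (nn + 2) * (r₁ + r₂ * (1 - r₁))) - 2) * c0 + (p * (1 + (nn + 1) * (r₁ + r₂ * (1 - r₁))) - 1) * c1 + (nn + 1 - (1 - p) * ((1 - r₁) * (1 - r₂))) * d →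
        False := by
  simp only [certContains, Bool.and_eq_true, decide_eq_true_eq] at hcont
  obtain ⟨⟨⟨⟨⟨⟨hD, hP0⟩, hP1⟩, hU0⟩, hU1⟩, hV0⟩, hV1⟩ := hcont
  have hDpos : (0 : ℝ) < c.D := by exact_mod_cast hD
  have hP0' : ((c.P0 : ℚ) : ℝ) ≤ ((c.D : ℚ) : ℝ) * (B.plo : ℝ) := by exact_mod_cast hP0
  have hP1' : ((c.D : ℚ) : ℝ) * (B.phi : ℝ) ≤ ((c.P1 : ℚ) : ℝ) := by exact_mod_cast hP1
  have hU0' : ((c.U0 : ℚ) : ℝ) ≤ ((c.D : ℚ) : ℝ) * (1 - (B.r1hi : ℝ)) := by exact_mod_cast hU0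
  have hU1' : ((c.D : ℚ) : ℝ) * (1 - (B.r1lo : ℝ)) ≤ ((c.U1 : ℚ) : ℝ) := by exact_mod_cast hU1
  have hV0' : ((c.V0 : ℚ) : ℝ) ≤ ((c.D : ℚ) : ℝ) * (1 - (B.r2hi : ℝ)) := by exact_mod_cast hV0
  have hV1' : ((c.D : ℚ) : ℝ) * (1 - ((max B.r2lo B.r1lo : ℚ) : ℝ)) ≤ ((c.V1 : ℚ) : ℝ) := by exact_mod_cast hV1
  have hmax : ((max B.r2lo B.r1lo : ℚ) : ℝ) ≤ r₂ := by
    rw [Rat.cast_max]; exact max_le h2lo (h1lo.trans hr12)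
  simp only [Rat.cast_natCast] at hP0' hP1' hU0' hU1' hV0' hV1'
  exact sound c hchk p r₁ r₂ nn hp hr12 hr2 hr10
    (hP0'.trans (by nlinarith)) (le_trans (by nlinarith) hP1')
    (hU0'.trans (by nlinarith)) (le_trans (by nlinarith) hU1')
    (hV0'.trans (by nlinarith)) (le_trans (by nlinarith) hV1') hwS hwE

/-- Walking a chain: if `nn·p` is at least the lower window end of `prev`, some certificate of `prev :: rest` applies. -/
theorem tail_sound (B : QBox) (prev : Cert) (rest : List Cert) (hok : tailOk B prev rest = true)
    (hall : ∀ c ∈ prev :: rest, check c = true ∧ certContains c B = true) (p r₁ r₂ nn : ℝ)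
    (hplo : (B.plo : ℝ) ≤ p) (hphi : p ≤ B.phi) (h1lo : (B.r1lo : ℝ) ≤ r₁) (h1hi : r₁ ≤ B.r1hi) (h2lo : (B.r2lo : ℝ) ≤ r₂) (h2hi : r₂ ≤ B.r2hi)
    (hp : 0 < p) (hr10 : 0 ≤ r₁) (hr12 : r₁ ≤ r₂) (hr2 : r₂ < 1)
    (hwS : prev.sfree = true ∨ (prev.SS : ℝ) + prev.SS1 * p ≤ prev.D * p * nn) :
    ∀ (a0 a1 a2 b1 b2 c0 c1 d : ℝ), 0 ≤ a0 → 0 ≤ a1 → 0 ≤ a2 → 0 ≤ b1 → 0 ≤ b2 → 0 ≤ c0 → 0 ≤ c1 → 0 ≤ d →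
        b1 * (b2 + (c0 + c1)) ≤ (a0 + a1 + a2) * d →
        b2 * (b1 + (c0 + c1)) ≤ (a0 + a1 + a2) * d →
        (c0 + c1) * (b1 + b2) ≤ (a0 + a1 + a2) * d →
        b1 * (a1 + a2 + c1 + d) ≤ d * (a0 + b1 + b2 + c0) →
        b2 * (a1 + a2 + c1 + d) ≤ d * (a0 + b1 + b2 + c0) →
        c0 * (a1 + a2 + c1 + d) ≤ (c1 + d) * (a0 + b1 + b2 + c0) →
        0 < p * ((1 - r₁) * (1 - r₂)) * (a0 + c0) - (1 - p) * a2 - (1 - p) * ((1 - r₁) * (1 - r₂)) * d →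
        0 < (1 - p) * (1 - r₁) * b1 - p * (r₂ * (1 - r₁)) * a0 - p * (1 - r₁) * a1 - (1 - p * r₁) * a2 - (1 - (1 - p) * (1 - r₂)) * (1 - r₁) * b2 - p * ((1 - r₁) * (1 - r₂)) * c1 →
        0 < (1 - p) * (1 - r₂) * b2 - p * (r₁ * (1 - r₂)) * a0 - p * (1 - r₂) * a1 - (1 - p * r₂) * a2 - (1 - (1 - p) * (1 - r₁)) * (1 - r₂) * b1 - p * ((1 - r₁) * (1 - r₂)) * c1 →
        0 < (1 - p * max r₁ r₂ - nn * p * (1 - max r₁ r₂)) * a1 + (1 - p * (r₁ + r₂ * (1 - r₁)) - nn * p * ((1 - r₁) * (1 - r₂))) * c1 - nn * p * (r₁ + r₂ * (1 - r₁) - max r₁ r₂) * a0 - nn * ((1 - (1 - p) * (1 - r₁)) * (1 - r₂)) * b1 - nn * ((1 - (1 - p) * (1 - r₂)) * (1 - r₁)) * b2 →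
        0 < (p * (1 + r₁ + r₂ + nn * max r₁ r₂) - 2) * a0 + (p * (1 + r₁ + r₂) + p * max r₁ r₂ * (nn - 1) - 1) * a1 + (p * (1 + r₁ + r₂) + nn - 2) * a2 + ((1 - (1 - p) * (1 - r₁)) * (1 + r₂ * (nn + 1)) - 1) * b1 + ((1 - (1 - p) * (1 - r₂)) * (1 + r₁ * (nn + 1)) - 1) * b2 + (p * (1 + (nn + 2) * (r₁ + r₂ * (1 - r₁))) - 2) * c0 + (p * (1 + (nn + 1) * (r₁ + r₂ * (1 - r₁))) - 1) * c1 + (nn + 1 - (1 - p) * ((1 - r₁) * (1 - r₂))) * d →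
        False := by
  induction rest generalizing prev with
  | nil =>
    simp only [tailOk] at hok
    obtain ⟨hc, hcont⟩ := hall prev (by simp)
    exact cert_apply prev B hc hcont p r₁ r₂ nn hplo hphi h1lo h1hi h2lo h2hi hp hr10 hr12 hr2 hwS (Or.inl hok)
  | cons c rest ih =>
    simp only [tailOk, Bool.and_eq_true, Bool.or_eq_true] at hok
    obtain ⟨hlink, hok'⟩ := hok
    obtain ⟨hc, hcont⟩ := hall prev (by simp)
    by_cases hE : prev.efree = true
    · exact cert_apply prev B hc hcont p r₁ r₂ nn hplo hphi h1lo h1hi h2lo h2hi hp hr10 hr12 hr2 hwS (Or.inl hE)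
    · by_cases hle : (prev.D : ℝ) * p * nn ≤ prev.SE + prev.SE1 * p
      · exact cert_apply prev B hc hcont p r₁ r₂ nn hplo hphi h1lo h1hi h2lo h2hi hp hr10 hr12 hr2 hwS (Or.inr hle)
      · push Not at hle
        apply ih c hok' (fun c' hc' => hall c' (by simp [hc']))
        rcases hlink with (h | h) | h
        · exact absurd h hE
        · exact Or.inl h
        · right
          simp only [linkAt, decide_eq_true_eq] at h
          obtain ⟨hlo', hhi'⟩ := h
          have hDc : (0 : ℝ) < c.D := by
            have := (hall c (by simp)).2
            simp only [certContains, Bool.and_eq_true, decide_eq_true_eq] at this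
            exact_mod_cast this.1.1.1.1.1.1
          have hDp : 0 < (prev.D : ℝ) := by
            have := hcont
            simp only [certContains, Bool.and_eq_true, decide_eq_true_eq] at this
            exact_mod_cast this.1.1.1.1.1.1
          have hlo'' : (((c.SS : ℚ) + c.SS1 * B.plo) * prev.D : ℚ) ≤ ((prev.SE : ℚ) + prev.SE1 * B.plo) * c.D := hlo'
          have hhi'' : (((c.SS : ℚ) + c.SS1 * B.phi) * prev.D : ℚ) ≤ ((prev.SE : ℚ) + prev.SE1 * B.phi) * c.D := hhi'
          have hloR : ((c.SS : ℝ) * prev.D) + ((c.SS1 : ℝ) * prev.D) * (B.plo : ℝ) ≤ ((prev.SE : ℝ) * c.D) + ((prev.SE1 : ℝ) * c.D) * (B.plo : ℝ) := by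
            have := (Rat.cast_le (K := ℝ)).2 hlo''; push_cast at this; linarith
          have hhiR : ((c.SS : ℝ) * prev.D) + ((c.SS1 : ℝ) * prev.D) * (B.phi : ℝ) ≤ ((prev.SE : ℝ) * c.D) + ((prev.SE1 : ℝ) * c.D) * (B.phi : ℝ) := by
            have := (Rat.cast_le (K := ℝ)).2 hhi''; push_cast at this; linarith
          have hmid := affine_le_between _ _ _ _ _ _ p hloR hhiR hplo hphi
          -- (SS_c + SS1_c p)·D_prev ≤ (SE_prev + SE1_prev p)·D_c < D_prev p nn · D_c
          have h2 : ((prev.SE : ℝ) + prev.SE1 * p) * c.D < (prev.D : ℝ) * p * nn * c.D := mul_lt_mul_of_pos_right hle hDc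
          have h3 : ((c.SS : ℝ) + c.SS1 * p) * prev.D < ((c.D : ℝ) * p * nn) * prev.D := by nlinarith
          exact (lt_of_mul_lt_mul_right h3 hDp.le).le

/-- A leaf chain proves the statement on its box for every `nn ≥ 1`. -/
theorem chain_sound (B : QBox) (chain : List Cert) (hok : chainOk B chain = true)
    (hall : ∀ c ∈ chain, check c = true ∧ certContains c B = true) (p r₁ r₂ nn : ℝ)
    (hplo : (B.plo : ℝ) ≤ p) (hphi : p ≤ B.phi) (h1lo : (B.r1lo : ℝ) ≤ r₁) (h1hi : r₁ ≤ B.r1hi) (h2lo : (B.r2lo : ℝ) ≤ r₂) (h2hi : r₂ ≤ B.r2hi)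
    (hp : 0 < p) (hr10 : 0 ≤ r₁) (hr12 : r₁ ≤ r₂) (hr2 : r₂ < 1) (hnn : 1 ≤ nn) :
    ∀ (a0 a1 a2 b1 b2 c0 c1 d : ℝ), 0 ≤ a0 → 0 ≤ a1 → 0 ≤ a2 → 0 ≤ b1 → 0 ≤ b2 → 0 ≤ c0 → 0 ≤ c1 → 0 ≤ d →
        b1 * (b2 + (c0 + c1)) ≤ (a0 + a1 + a2) * d →
        b2 * (b1 + (c0 + c1)) ≤ (a0 + a1 + a2) * d →
        (c0 + c1) * (b1 + b2) ≤ (a0 + a1 + a2) * d →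
        b1 * (a1 + a2 + c1 + d) ≤ d * (a0 + b1 + b2 + c0) →
        b2 * (a1 + a2 + c1 + d) ≤ d * (a0 + b1 + b2 + c0) →
        c0 * (a1 + a2 + c1 + d) ≤ (c1 + d) * (a0 + b1 + b2 + c0) →
        0 < p * ((1 - r₁) * (1 - r₂)) * (a0 + c0) - (1 - p) * a2 - (1 - p) * ((1 - r₁) * (1 - r₂)) * d →
        0 < (1 - p) * (1 - r₁) * b1 - p * (r₂ * (1 - r₁)) * a0 - p * (1 - r₁) * a1 - (1 - p * r₁) * a2 - (1 - (1 - p) * (1 - r₂)) * (1 - r₁) * b2 - p * ((1 - r₁) * (1 - r₂)) * c1 →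
        0 < (1 - p) * (1 - r₂) * b2 - p * (r₁ * (1 - r₂)) * a0 - p * (1 - r₂) * a1 - (1 - p * r₂) * a2 - (1 - (1 - p) * (1 - r₁)) * (1 - r₂) * b1 - p * ((1 - r₁) * (1 - r₂)) * c1 →
        0 < (1 - p * max r₁ r₂ - nn * p * (1 - max r₁ r₂)) * a1 + (1 - p * (r₁ + r₂ * (1 - r₁)) - nn * p * ((1 - r₁) * (1 - r₂))) * c1 - nn * p * (r₁ + r₂ * (1 - r₁) - max r₁ r₂) * a0 - nn * ((1 - (1 - p) * (1 - r₁)) * (1 - r₂)) * b1 - nn * ((1 - (1 - p) * (1 - r₂)) * (1 - r₁)) * b2 →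
        0 < (p * (1 + r₁ + r₂ + nn * max r₁ r₂) - 2) * a0 + (p * (1 + r₁ + r₂) + p * max r₁ r₂ * (nn - 1) - 1) * a1 + (p * (1 + r₁ + r₂) + nn - 2) * a2 + ((1 - (1 - p) * (1 - r₁)) * (1 + r₂ * (nn + 1)) - 1) * b1 + ((1 - (1 - p) * (1 - r₂)) * (1 + r₁ * (nn + 1)) - 1) * b2 + (p * (1 + (nn + 2) * (r₁ + r₂ * (1 - r₁))) - 2) * c0 + (p * (1 + (nn + 1) * (r₁ + r₂ * (1 - r₁))) - 1) * c1 + (nn + 1 - (1 - p) * ((1 - r₁) * (1 - r₂))) * d →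
        False := by
  cases chain with
  | nil => simp [chainOk] at hok
  | cons c rest =>
    simp only [chainOk, Bool.and_eq_true, Bool.or_eq_true] at hok
    obtain ⟨hfirst, hok'⟩ := hok
    apply tail_sound B c rest hok' hall p r₁ r₂ nn hplo hphi h1lo h1hi h2lo h2hi hp hr10 hr12 hr2
    rcases hfirst with h | h
    · exact Or.inl h
    · right
      simp only [startAt, decide_eq_true_eq] at h
      obtain ⟨hlo', hhi'⟩ := h
      have hloR : (c.SS : ℝ) + (c.SS1 : ℝ) * (B.plo : ℝ) ≤ 0 + (c.D : ℝ) * (B.plo : ℝ) := by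
        have := (Rat.cast_le (K := ℝ)).2 hlo'; push_cast at this; linarith
      have hhiR : (c.SS : ℝ) + (c.SS1 : ℝ) * (B.phi : ℝ) ≤ 0 + (c.D : ℝ) * (B.phi : ℝ) := by
        have := (Rat.cast_le (K := ℝ)).2 hhi'; push_cast at this; linarith
      have hmid := affine_le_between _ _ _ _ _ _ p hloR hhiR hplo hphi
      have hD0 : (0 : ℝ) ≤ c.D := by exact_mod_cast Nat.zero_le _
      nlinarith [mul_nonneg hD0 hp.le]

/-- **Coverage theorem.** -/
theorem tree_sound : ∀ (fuel : ℕ) (t : Tree) (B : QBox), covers fuel t B = true → ∀ (p r₁ r₂ nn : ℝ),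
    (B.plo : ℝ) ≤ p → p ≤ B.phi → (B.r1lo : ℝ) ≤ r₁ → r₁ ≤ B.r1hi → (B.r2lo : ℝ) ≤ r₂ → r₂ ≤ B.r2hi →
    0 < p → 0 ≤ r₁ → r₁ ≤ r₂ → r₂ < 1 → 1 ≤ nn →
    ∀ (a0 a1 a2 b1 b2 c0 c1 d : ℝ), 0 ≤ a0 → 0 ≤ a1 → 0 ≤ a2 → 0 ≤ b1 → 0 ≤ b2 → 0 ≤ c0 → 0 ≤ c1 → 0 ≤ d →
        b1 * (b2 + (c0 + c1)) ≤ (a0 + a1 + a2) * d →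
        b2 * (b1 + (c0 + c1)) ≤ (a0 + a1 + a2) * d →
        (c0 + c1) * (b1 + b2) ≤ (a0 + a1 + a2) * d →
        b1 * (a1 + a2 + c1 + d) ≤ d * (a0 + b1 + b2 + c0) →
        b2 * (a1 + a2 + c1 + d) ≤ d * (a0 + b1 + b2 + c0) →
        c0 * (a1 + a2 + c1 + d) ≤ (c1 + d) * (a0 + b1 + b2 + c0) →
        0 < p * ((1 - r₁) * (1 - r₂)) * (a0 + c0) - (1 - p) * a2 - (1 - p) * ((1 - r₁) * (1 - r₂)) * d →
        0 < (1 - p) * (1 - r₁) * b1 - p * (r₂ * (1 - r₁)) * a0 - p * (1 - r₁) * a1 - (1 - p * r₁) * a2 - (1 - (1 - p) * (1 - r₂)) * (1 - r₁) * b2 - p * ((1 - r₁) * (1 - r₂)) * c1 →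
        0 < (1 - p) * (1 - r₂) * b2 - p * (r₁ * (1 - r₂)) * a0 - p * (1 - r₂) * a1 - (1 - p * r₂) * a2 - (1 - (1 - p) * (1 - r₁)) * (1 - r₂) * b1 - p * ((1 - r₁) * (1 - r₂)) * c1 →
        0 < (1 - p * max r₁ r₂ - nn * p * (1 - max r₁ r₂)) * a1 + (1 - p * (r₁ + r₂ * (1 - r₁)) - nn * p * ((1 - r₁) * (1 - r₂))) * c1 - nn * p * (r₁ + r₂ * (1 - r₁) - max r₁ r₂) * a0 - nn * ((1 - (1 - p) * (1 - r₁)) * (1 - r₂)) * b1 - nn * ((1 - (1 - p) * (1 - r₂)) * (1 - r₁)) * b2 →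
        0 < (p * (1 + r₁ + r₂ + nn * max r₁ r₂) - 2) * a0 + (p * (1 + r₁ + r₂) + p * max r₁ r₂ * (nn - 1) - 1) * a1 + (p * (1 + r₁ + r₂) + nn - 2) * a2 + ((1 - (1 - p) * (1 - r₁)) * (1 + r₂ * (nn + 1)) - 1) * b1 + ((1 - (1 - p) * (1 - r₂)) * (1 + r₁ * (nn + 1)) - 1) * b2 + (p * (1 + (nn + 2) * (r₁ + r₂ * (1 - r₁))) - 2) * c0 + (p * (1 + (nn + 1) * (r₁ + r₂ * (1 - r₁))) - 1) * c1 + (nn + 1 - (1 - p) * ((1 - r₁) * (1 - r₂))) * d →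
        False
  | 0, t, B, hcov => by simp [covers] at hcov
  | fuel + 1, Tree.leaf chain, B, hcov => by
    intro p r₁ r₂ nn hplo hphi h1lo h1hi h2lo h2hi hp hr10 hr12 hr2 hnn
    simp only [covers, Bool.and_eq_true, List.all_eq_true] at hcov
    obtain ⟨hok, hall⟩ := hcov
    exact chain_sound B chain hok (fun c hc => hall c hc) p r₁ r₂ nn hplo hphi h1lo h1hi h2lo h2hi hp hr10 hr12 hr2 hnn
  | fuel + 1, Tree.node ax t tlo thi, B, hcov => by
    intro p r₁ r₂ nn hplo hphi h1lo h1hi h2lo h2hi hp hr10 hr12 hr2 hnn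
    simp only [covers, Bool.and_eq_true] at hcov
    obtain ⟨hclo, hchi⟩ := hcov
    have ihlo := tree_sound fuel tlo (B.cut ax t true) hclo p r₁ r₂ nn
    have ihhi := tree_sound fuel thi (B.cut ax t false) hchi p r₁ r₂ nn
    rcases Nat.lt_or_ge ax 1 with hax | hax
    · have hax0 : ax = 0 := by omega
      subst hax0
      rcases le_total p (t : ℝ) with hle | hge
      · exact ihlo (by simpa [QBox.cut] using hplo) (by simpa [QBox.cut] using hle) (by simpa [QBox.cut] using h1lo)
          (by simpa [QBox.cut] using h1hi) (by simpa [QBox.cut] using h2lo) (by simpa [QBox.cut] using h2hi) hp hr10 hr12 hr2 hnn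
      · exact ihhi (by simpa [QBox.cut] using hge) (by simpa [QBox.cut] using hphi) (by simpa [QBox.cut] using h1lo)
          (by simpa [QBox.cut] using h1hi) (by simpa [QBox.cut] using h2lo) (by simpa [QBox.cut] using h2hi) hp hr10 hr12 hr2 hnn
    · rcases Nat.lt_or_ge ax 2 with hax1 | hax2
      · have hax1' : ax = 1 := by omega
        subst hax1'
        rcases le_total r₁ (t : ℝ) with hle | hge
        · exact ihlo (by simpa [QBox.cut] using hplo) (by simpa [QBox.cut] using hphi) (by simpa [QBox.cut] using h1lo)
            (by simpa [QBox.cut] using hle) (by simpa [QBox.cut] using h2lo) (by simpa [QBox.cut] using h2hi) hp hr10 hr12 hr2 hnn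
        · exact ihhi (by simpa [QBox.cut] using hplo) (by simpa [QBox.cut] using hphi) (by simpa [QBox.cut] using hge)
            (by simpa [QBox.cut] using h1hi) (by simpa [QBox.cut] using h2lo) (by simpa [QBox.cut] using h2hi) hp hr10 hr12 hr2 hnn
      · obtain ⟨m, hm⟩ : ∃ m, ax = m + 2 := ⟨ax - 2, by omega⟩
        subst hm
        rcases le_total r₂ (t : ℝ) with hle | hge
        · exact ihlo (by simpa [QBox.cut] using hplo) (by simpa [QBox.cut] using hphi) (by simpa [QBox.cut] using h1lo)
            (by simpa [QBox.cut] using h1hi) (by simpa [QBox.cut] using h2lo) (by simpa [QBox.cut] using hle) hp hr10 hr12 hr2 hnn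
        · exact ihhi (by simpa [QBox.cut] using hplo) (by simpa [QBox.cut] using hphi) (by simpa [QBox.cut] using h1lo)
            (by simpa [QBox.cut] using h1hi) (by simpa [QBox.cut] using hge) (by simpa [QBox.cut] using h2hi) hp hr10 hr12 hr2 hnn

/-- The 8-cell statement on the part `0 < p`, `0 ≤ r₁ ≤ r₂ < 1` of the rational box `B`, for every real `nn ≥ 1` (the shape of every region /
leaf theorem of the data files). -/
def BoxOK (B : QBox) : Prop := ∀ (p r₁ r₂ nn : ℝ),
    (B.plo : ℝ) ≤ p → p ≤ B.phi → (B.r1lo : ℝ) ≤ r₁ → r₁ ≤ B.r1hi → (B.r2lo : ℝ) ≤ r₂ → r₂ ≤ B.r2hi →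
    0 < p → 0 ≤ r₁ → r₁ ≤ r₂ → r₂ < 1 → 1 ≤ nn →
    ∀ (a0 a1 a2 b1 b2 c0 c1 d : ℝ), 0 ≤ a0 → 0 ≤ a1 → 0 ≤ a2 → 0 ≤ b1 → 0 ≤ b2 → 0 ≤ c0 → 0 ≤ c1 → 0 ≤ d →
        b1 * (b2 + (c0 + c1)) ≤ (a0 + a1 + a2) * d →
        b2 * (b1 + (c0 + c1)) ≤ (a0 + a1 + a2) * d →
        (c0 + c1) * (b1 + b2) ≤ (a0 + a1 + a2) * d →
        b1 * (a1 + a2 + c1 + d) ≤ d * (a0 + b1 + b2 + c0) →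
        b2 * (a1 + a2 + c1 + d) ≤ d * (a0 + b1 + b2 + c0) →
        c0 * (a1 + a2 + c1 + d) ≤ (c1 + d) * (a0 + b1 + b2 + c0) →
        0 < p * ((1 - r₁) * (1 - r₂)) * (a0 + c0) - (1 - p) * a2 - (1 - p) * ((1 - r₁) * (1 - r₂)) * d →
        0 < (1 - p) * (1 - r₁) * b1 - p * (r₂ * (1 - r₁)) * a0 - p * (1 - r₁) * a1 - (1 - p * r₁) * a2 - (1 - (1 - p) * (1 - r₂)) * (1 - r₁) * b2 - p * ((1 - r₁) * (1 - r₂)) * c1 →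
        0 < (1 - p) * (1 - r₂) * b2 - p * (r₁ * (1 - r₂)) * a0 - p * (1 - r₂) * a1 - (1 - p * r₂) * a2 - (1 - (1 - p) * (1 - r₁)) * (1 - r₂) * b1 - p * ((1 - r₁) * (1 - r₂)) * c1 →
        0 < (1 - p * max r₁ r₂ - nn * p * (1 - max r₁ r₂)) * a1 + (1 - p * (r₁ + r₂ * (1 - r₁)) - nn * p * ((1 - r₁) * (1 - r₂))) * c1 - nn * p * (r₁ + r₂ * (1 - r₁) - max r₁ r₂) * a0 - nn * ((1 - (1 - p) * (1 - r₁)) * (1 - r₂)) * b1 - nn * ((1 - (1 - p) * (1 - r₂)) * (1 - r₁)) * b2 →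
        0 < (p * (1 + r₁ + r₂ + nn * max r₁ r₂) - 2) * a0 + (p * (1 + r₁ + r₂) + p * max r₁ r₂ * (nn - 1) - 1) * a1 + (p * (1 + r₁ + r₂) + nn - 2) * a2 + ((1 - (1 - p) * (1 - r₁)) * (1 + r₂ * (nn + 1)) - 1) * b1 + ((1 - (1 - p) * (1 - r₂)) * (1 + r₁ * (nn + 1)) - 1) * b2 + (p * (1 + (nn + 2) * (r₁ + r₂ * (1 - r₁))) - 2) * c0 + (p * (1 + (nn + 1) * (r₁ + r₂ * (1 - r₁))) - 1) * c1 + (nn + 1 - (1 - p) * ((1 - r₁) * (1 - r₂))) * d →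
        False

/-- A covered box satisfies `BoxOK`. -/
theorem boxOK_of_covers (fuel : ℕ) (t : Tree) (B : QBox) (h : covers fuel t B = true) : BoxOK B :=
  tree_sound fuel t B h

/-- The same statement with the six box bounds as real parameters (the shape used by the dispatch theorems). -/
def BoxOKR (plo phi r1lo r1hi r2lo r2hi : ℝ) : Prop := ∀ (p r₁ r₂ nn : ℝ),
    plo ≤ p → p ≤ phi → r1lo ≤ r₁ → r₁ ≤ r1hi → r2lo ≤ r₂ → r₂ ≤ r2hi →
    0 < p → 0 ≤ r₁ → r₁ ≤ r₂ → r₂ < 1 → 1 ≤ nn →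
    ∀ (a0 a1 a2 b1 b2 c0 c1 d : ℝ), 0 ≤ a0 → 0 ≤ a1 → 0 ≤ a2 → 0 ≤ b1 → 0 ≤ b2 → 0 ≤ c0 → 0 ≤ c1 → 0 ≤ d →
        b1 * (b2 + (c0 + c1)) ≤ (a0 + a1 + a2) * d →
        b2 * (b1 + (c0 + c1)) ≤ (a0 + a1 + a2) * d →
        (c0 + c1) * (b1 + b2) ≤ (a0 + a1 + a2) * d →
        b1 * (a1 + a2 + c1 + d) ≤ d * (a0 + b1 + b2 + c0) →
        b2 * (a1 + a2 + c1 + d) ≤ d * (a0 + b1 + b2 + c0) →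
        c0 * (a1 + a2 + c1 + d) ≤ (c1 + d) * (a0 + b1 + b2 + c0) →
        0 < p * ((1 - r₁) * (1 - r₂)) * (a0 + c0) - (1 - p) * a2 - (1 - p) * ((1 - r₁) * (1 - r₂)) * d →
        0 < (1 - p) * (1 - r₁) * b1 - p * (r₂ * (1 - r₁)) * a0 - p * (1 - r₁) * a1 - (1 - p * r₁) * a2 - (1 - (1 - p) * (1 - r₂)) * (1 - r₁) * b2 - p * ((1 - r₁) * (1 - r₂)) * c1 →
        0 < (1 - p) * (1 - r₂) * b2 - p * (r₁ * (1 - r₂)) * a0 - p * (1 - r₂) * a1 - (1 - p * r₂) * a2 - (1 - (1 - p) * (1 - r₁)) * (1 - r₂) * b1 - p * ((1 - r₁) * (1 - r₂)) * c1 →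
        0 < (1 - p * max r₁ r₂ - nn * p * (1 - max r₁ r₂)) * a1 + (1 - p * (r₁ + r₂ * (1 - r₁)) - nn * p * ((1 - r₁) * (1 - r₂))) * c1 - nn * p * (r₁ + r₂ * (1 - r₁) - max r₁ r₂) * a0 - nn * ((1 - (1 - p) * (1 - r₁)) * (1 - r₂)) * b1 - nn * ((1 - (1 - p) * (1 - r₂)) * (1 - r₁)) * b2 →
        0 < (p * (1 + r₁ + r₂ + nn * max r₁ r₂) - 2) * a0 + (p * (1 + r₁ + r₂) + p * max r₁ r₂ * (nn - 1) - 1) * a1 + (p * (1 + r₁ + r₂) + nn - 2) * a2 + ((1 - (1 - p) * (1 - r₁)) * (1 + r₂ * (nn + 1)) - 1) * b1 + ((1 - (1 - p) * (1 - r₂)) * (1 + r₁ * (nn + 1)) - 1) * b2 + (p * (1 + (nn + 2) * (r₁ + r₂ * (1 - r₁))) - 2) * c0 + (p * (1 + (nn + 1) * (r₁ + r₂ * (1 - r₁))) - 1) * c1 + (nn + 1 - (1 - p) * ((1 - r₁) * (1 - r₂))) * d →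
        False

/-- `BoxOK B` is `BoxOKR` of the cast bounds. -/
theorem boxOKR_of_boxOK (B : QBox) (h : BoxOK B) : BoxOKR (B.plo : ℝ) B.phi B.r1lo B.r1hi B.r2lo B.r2hi :=
  h

end BoxCover

end Quant

end Summit.CriticalPhenomena.PercolationContinuityZ3.Theorems
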